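import Summits.QuantumFields.YangMills.Theorems.PoincareLipschitzSphereMapOneStepLogFree

/-!
# Line «poincare_lipschitz» on crux `HistoryTailL` (stmt-QuantumFields-19936) — K2 organ of record `hImproveCoreFlat` (RULING g9-8, text v1 bac8eda30a54887f):
# FILE K-6 «THE HALVING INSTANCE BELOW THRESHOLD, BY KERNEL»

Cell `ym3-torus` (YM ladder rung R3 = continuum SU(2) Yang–Mills on the three-torus — a RUNG, NOT the Clay problem: not `d = 4`, not infinite volume,
not a mass gap); LEAD seat `ym-ust-19936-w1` gen 9.  THEOREMS ONLY (def-free); `--supports stmt-QuantumFields-19936`.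

The organ of record `hImproveCoreFlat` (LEAD w1 g9, FROZEN v1) is, by ★w7 g13's `flat_of_halving`/`halving_of_flat`, EQUIVALENT to its diagonal HALVING instance
«for every `Λ > 0`: unit maps `u : ℤ³ → S³ ⊂ ℝ⁴` carrying the flat almost-minimality row (slack `δ·(ρ+1)` in every sub-box) with `E(Q_R(z)) ≤ ΛR`, `R ≥ R₀`,
have `E(Q_{2r}(z)) ≤ Λ·r` at one comparable scale `r ∈ [R∕C₀, R∕4]`» (RULING g9-10: the supplier's target).  This file proves the halving instance
UNCONDITIONALLY at every level `Λ` BELOW A FIXED THRESHOLD `Λ⋆ > 0` (§2 ★★`halving_below_threshold`), from ★w5 g12's log-free small-energy one-step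
✓`PoincareLipschitzSphereMapOneStepLogFree.hLogFreeOneStep_holds` applied once at the top box with the row's slack `δR`: with `M ≥ 8`, `M² ≥ 216A`,
`ε := 1∕(8M)`, `Λ⋆ := ε₁(ε)`, `C₀ := R₀ := 2M`, `δ := Λ∕(16M)` and `r := ⌊R∕M⌋` the one-step bound
`E(Q_{2r}) ≤ (A((2r+1)∕R)³ + ε)·E(Q_R) + 2δR ≤ (54A∕M² + 1∕4 + 1∕4)·Λr ≤ Λr`.
Hence (§3 ★`halving_of_large`, pure logic) the halving organ at ALL levels follows from the halving organ at the levels `Λ ≥ Λ⋆` alone: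
what remains of the K2 organ is the LARGE-normalised-energy halving — the Schoen–Uhlenbeck 1984 ∕ Luckhaus 1988 content, not in print on `ℤ³`.
* §1 pure-real and integer letters (`oneStep_budget`, `ediv_window`); §2 ★★`halving_below_threshold`; §3 ★`halving_of_large`.
HONEST: nothing here proves the organ, `hImproveCore`, `hImprove`, K1, `MeanDeviationL`, `BlockLipschitzL`, `HistoryTailL` or a summit statement.
[folklore] ([SchoenUhlenbeck1982] §4 small-energy one-step improvement; lattice constants are the imported file's).
-/

set_option autoImplicit false

noncomputable section

open scoped BigOperators InnerProductSpace
open Finset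

namespace Summit.QuantumFields.YangMills.Theorems.PoincareLipschitzFlatOrganBelowThreshold

open Literature.MathematicalPhysics.QuantumFieldTheory.Balaban1983to89
open B4Eq19LatticeOperators
open Summit.QuantumFields.YangMills.Theorems.PoincareLipschitzSphereMapOneStepLogFree (hLogFreeOneStep_holds)

/-! ## §1 Letters -/

/-- The one-step budget: with `M ≥ 8`, `216A ≤ M²`, `M r ≤ R ≤ 2M r`, `0 < r`, `E ≤ ΛR`, `0 ≤ Λ`,
`(A((2r+1)∕R)³ + 1∕(8M))·E + 2(Λ∕(16M))R ≤ Λr`. [folklore] -/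
theorem oneStep_budget {A M R r E Λ : ℝ} (hA : 0 ≤ A) (hM : 8 ≤ M) (hAM : 216 * A ≤ M ^ 2)
    (hr : 1 ≤ r) (hMr : M * r ≤ R) (hR2 : R ≤ 2 * M * r) (hΛ : 0 ≤ Λ) (hE0 : 0 ≤ E) (hE : E ≤ Λ * R) :
    (A * ((2 * r + 1) / R) ^ 3 + 1 / (8 * M)) * E + 2 * (Λ / (16 * M) * R) ≤ Λ * r := by
  have hM0 : 0 < M := by linarith
  have hr0 : 0 < r := by linarith
  have hR0 : 0 < R := lt_of_lt_of_le (by positivity) hMr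
  -- the cube `((2r+1)/R)³ ≤ (3/M)³ = 27/M³`
  have hfrac : (2 * r + 1) / R ≤ 3 / M := by
    rw [div_le_div_iff₀ hR0 hM0]
    nlinarith
  have hcube : ((2 * r + 1) / R) ^ 3 ≤ (3 / M) ^ 3 :=
    pow_le_pow_left₀ (by positivity) hfrac 3
  have hcube' : A * ((2 * r + 1) / R) ^ 3 ≤ A * (27 / M ^ 3) := by
    have : (3 / M) ^ 3 = 27 / M ^ 3 := by ring
    rw [← this]; exact mul_le_mul_of_nonneg_left hcube hA
  -- first term
  have hT1 : (A * ((2 * r + 1) / R) ^ 3 + 1 / (8 * M)) * E ≤ (A * (27 / M ^ 3) + 1 / (8 * M)) * (Λ * (2 * M * r)) := by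
    calc (A * ((2 * r + 1) / R) ^ 3 + 1 / (8 * M)) * E
        ≤ (A * (27 / M ^ 3) + 1 / (8 * M)) * E := by
          exact mul_le_mul_of_nonneg_right (by linarith) hE0
      _ ≤ (A * (27 / M ^ 3) + 1 / (8 * M)) * (Λ * (2 * M * r)) := by
          refine mul_le_mul_of_nonneg_left (hE.trans ?_) (by positivity)
          exact mul_le_mul_of_nonneg_left hR2 hΛ
  have hT1' : (A * (27 / M ^ 3) + 1 / (8 * M)) * (Λ * (2 * M * r)) = (54 * A / M ^ 2 + 1 / 4) * (Λ * r) := by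
    field_simp
    ring
  have h54 : 54 * A / M ^ 2 ≤ 1 / 4 := by
    rw [div_le_iff₀ (by positivity)]
    nlinarith
  -- second term
  have hT2 : 2 * (Λ / (16 * M) * R) ≤ Λ * r / 4 := by
    have : 2 * (Λ / (16 * M) * R) = Λ * R / (8 * M) := by field_simp; ring
    rw [this, div_le_iff₀ (by positivity)]
    have := mul_le_mul_of_nonneg_left hR2 hΛ
    nlinarith
  have hΛr : 0 ≤ Λ * r := mul_nonneg hΛ hr0.le
  calc (A * ((2 * r + 1) / R) ^ 3 + 1 / (8 * M)) * E + 2 * (Λ / (16 * M) * R)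
      ≤ (54 * A / M ^ 2 + 1 / 4) * (Λ * r) + Λ * r / 4 := by rw [← hT1']; exact add_le_add hT1 hT2
    _ ≤ (1 / 4 + 1 / 4) * (Λ * r) + Λ * r / 4 := by
        have := mul_le_mul_of_nonneg_right (add_le_add_right h54 (1 / 4)) hΛr
        linarith
    _ ≤ Λ * r := by linarith

/-- The integer window: for `0 < M` and `2M ≤ R`, `r := R / M` (integer division) has `1 ≤ r`, `M r ≤ R`, `R ≤ 2 M r`. [folklore] -/
theorem ediv_window {M R : ℤ} (hM : 0 < M) (hR : 2 * M ≤ R) :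
    1 ≤ R / M ∧ M * (R / M) ≤ R ∧ R ≤ 2 * M * (R / M) := by
  have h2 : 2 ≤ R / M := Int.le_ediv_of_mul_le hM (by linarith)
  have hdiv : M * (R / M) + R % M = R := Int.mul_ediv_add_emod R M
  have hmod0 : 0 ≤ R % M := Int.emod_nonneg R hM.ne'
  have hmodlt : R % M < M := Int.emod_lt_of_pos R hM
  refine ⟨by linarith, by linarith, ?_⟩
  nlinarith

/-! ## §2 The halving instance below threshold -/

/-- ★★ THE HALVING INSTANCE OF THE K2 ORGAN BELOW THRESHOLD, UNCONDITIONALLY: there is `Λ⋆ > 0` such that for every level `0 < Λ ≤ Λ⋆` the diagonal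
instance `(Λ₀, ε₁) := (Λ, Λ)` of `hImproveCoreFlat` holds — unit maps `ℤ³ → S³ ⊂ ℝ⁴` with the flat almost-minimality row (slack `δ(ρ+1)`,
`δ := Λ∕(16M)`) and `E(Q_R(z)) ≤ ΛR`, `R ≥ 2M`, have `E(Q_{2r}(z)) ≤ Λr` at `r := ⌊R∕M⌋ ∈ [R∕(2M), R∕M]`.  From ✓`hLogFreeOneStep_holds` at the top box.
[folklore] [cite: SchoenUhlenbeck1982, §4] -/
theorem halving_below_threshold :
    ∃ Λs : ℝ, 0 < Λs ∧ ∀ Λ : ℝ, 0 < Λ → Λ ≤ Λs →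
      ∃ (δ C₀ R₀ : ℝ), 0 < δ ∧ 1 ≤ C₀ ∧ 1 ≤ R₀ ∧
      ∀ (u : Zd 3 → EuclideanSpace ℝ (Fin 4)) (z : Zd 3) (R : ℤ),
        R₀ ≤ R →
        (∀ y, ‖u y‖ = 1) →
        (∀ (z' : Zd 3) (ρ : ℤ), 0 ≤ ρ → box z' (ρ + 1) ⊆ box z R →
          ∀ v : Zd 3 → EuclideanSpace ℝ (Fin 4), (∀ y, y ∉ box z' ρ → v y = u y) → (∀ y ∈ box z' ρ, ‖v y‖ = 1) →
            ∑ y ∈ box z' (ρ + 1), ∑ μ : Fin 3, ‖u (y + unitVec μ) - u y‖ ^ 2 ≤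
              (∑ y ∈ box z' (ρ + 1), ∑ μ : Fin 3, ‖v (y + unitVec μ) - v y‖ ^ 2) + δ * ((ρ : ℝ) + 1)) →
        (∑ y ∈ box z R, ∑ μ : Fin 3, ‖u (y + unitVec μ) - u y‖ ^ 2 ≤ Λ * R) →
        ∃ r : ℤ, 1 ≤ r ∧ (R : ℝ) ≤ C₀ * r ∧ 4 * r ≤ R ∧
          ∑ y ∈ box z (2 * r), ∑ μ : Fin 3, ‖u (y + unitVec μ) - u y‖ ^ 2 ≤ Λ * r := by
  obtain ⟨A, hA0, hstep⟩ := hLogFreeOneStep_holds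
  -- the integer `M ≥ 8` with `216 A ≤ M²`
  obtain ⟨N, hN⟩ := exists_nat_ge (216 * A)
  obtain ⟨Mn, hMn⟩ : ∃ Mn : ℕ, Mn = N + 8 := ⟨_, rfl⟩
  have hM8 : (8 : ℝ) ≤ (Mn : ℝ) := by rw [hMn]; push_cast; linarith
  have hM0 : (0 : ℝ) < (Mn : ℝ) := by linarith
  have hAM : 216 * A ≤ (Mn : ℝ) ^ 2 := by
    have h1 : (N : ℝ) ≤ Mn := by rw [hMn]; push_cast; linarith
    have h2 : (Mn : ℝ) ≤ (Mn : ℝ) ^ 2 := by nlinarith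
    linarith
  obtain ⟨ε₁, hε₁, hthr⟩ := hstep (1 / (8 * (Mn : ℝ))) (by positivity)
  refine ⟨ε₁, hε₁, fun Λ hΛ hΛs => ?_⟩
  refine ⟨Λ / (16 * Mn), 2 * Mn, 2 * Mn, by positivity, by linarith, by linarith, ?_⟩
  intro u z R hR hunit hrows hE
  -- the integer window
  have hMi : (0 : ℤ) < (Mn : ℤ) := by exact_mod_cast (show (0 : ℕ) < Mn by rw [hMn]; omega)
  have hR2 : 2 * (Mn : ℤ) ≤ R := by
    have : (2 : ℝ) * (Mn : ℝ) ≤ (R : ℝ) := hR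
    exact_mod_cast this
  obtain ⟨hr1, hMr, hRle⟩ := ediv_window hMi hR2
  obtain ⟨r, hr⟩ : ∃ r : ℤ, r = R / (Mn : ℤ) := ⟨_, rfl⟩
  rw [← hr] at hr1 hMr hRle
  have h8 : (8 : ℤ) ≤ (Mn : ℤ) := by exact_mod_cast (show (8 : ℕ) ≤ Mn by rw [hMn]; omega)
  have h8r : 8 * r ≤ R := le_trans (mul_le_mul_of_nonneg_right h8 (by linarith)) hMr
  refine ⟨r, hr1, ?_, ?_, ?_⟩
  · have : (R : ℝ) ≤ 2 * (Mn : ℝ) * (r : ℝ) := by exact_mod_cast hRle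
    simpa using this
  · linarith
  -- the one-step at the top box with slack `δ R`
  have hsl0 : 0 ≤ Λ / (16 * Mn) * (R : ℝ) := by
    have : (0 : ℝ) ≤ (R : ℝ) := by exact_mod_cast (show (0 : ℤ) ≤ R by nlinarith)
    positivity
  have hmin : ∀ w : Zd 3 → EuclideanSpace ℝ (Fin 4), (∀ y, ‖w y‖ = 1) → (∀ y, y ∉ box z (R - 1) → w y = u y) →
      ∑ y ∈ box z R, ∑ μ : Fin 3, ‖u (y + unitVec μ) - u y‖ ^ 2 ≤
        (∑ y ∈ box z R, ∑ μ : Fin 3, ‖w (y + unitVec μ) - w y‖ ^ 2) + Λ / (16 * Mn) * (R : ℝ) := by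
    intro w hw hwu
    have hρ0 : (0 : ℤ) ≤ R - 1 := by linarith
    have hsub : box z (R - 1 + 1) ⊆ box z R := by rw [sub_add_cancel]
    have h := hrows z (R - 1) hρ0 hsub w hwu (fun y _ => hw y)
    rw [sub_add_cancel] at h
    have hcast : ((R - 1 : ℤ) : ℝ) + 1 = (R : ℝ) := by push_cast; ring
    rw [hcast] at h
    exact h
  have hthrR : (∑ y ∈ box z R, ∑ μ : Fin 3, ‖u (y + unitVec μ) - u y‖ ^ 2) ≤ ε₁ * R := by
    refine hE.trans ?_
    have : (0 : ℝ) ≤ (R : ℝ) := by exact_mod_cast (show (0 : ℤ) ≤ R by nlinarith)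
    exact mul_le_mul_of_nonneg_right hΛs this
  have hone := hthr u z R _ hsl0 hunit hmin hthrR (2 * r) (by linarith) (by linarith)
  -- real arithmetic
  refine hone.trans ?_
  have hE0 : 0 ≤ ∑ y ∈ box z R, ∑ μ : Fin 3, ‖u (y + unitVec μ) - u y‖ ^ 2 := by positivity
  have hrR : (1 : ℝ) ≤ (r : ℝ) := by exact_mod_cast hr1
  have hMrR : (Mn : ℝ) * (r : ℝ) ≤ (R : ℝ) := by exact_mod_cast hMr
  have hR2R : (R : ℝ) ≤ 2 * (Mn : ℝ) * (r : ℝ) := by exact_mod_cast hRle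
  have key := oneStep_budget (E := ∑ y ∈ box z R, ∑ μ : Fin 3, ‖u (y + unitVec μ) - u y‖ ^ 2)
    hA0 hM8 hAM hrR hMrR hR2R hΛ.le hE0 hE
  have hcast2 : (((2 * r : ℤ) : ℝ) + 1) = 2 * (r : ℝ) + 1 := by push_cast; ring
  rw [hcast2]
  exact key

/-! ## §3 The organ's halving normal form reduces to the LARGE levels -/

/-- ★ PURE LOGIC over §2: the halving organ at ALL levels `Λ > 0` (the hypothesis of ★w7 g13's `flat_of_halving`, which yields `hImproveCoreFlat`
VERBATIM) follows from the halving organ at the levels `Λ ≥ Λ⋆` alone, `Λ⋆ > 0` the threshold of `halving_below_threshold`.  What remains of the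
K2 organ is therefore the LARGE-normalised-energy halving (Schoen–Uhlenbeck 1984 ∕ Luckhaus 1988 content). [folklore] -/
theorem halving_of_large :
    ∃ Λs : ℝ, 0 < Λs ∧
    ((∀ Λ : ℝ, Λs ≤ Λ →
      ∃ (δ C₀ R₀ : ℝ), 0 < δ ∧ 1 ≤ C₀ ∧ 1 ≤ R₀ ∧
      ∀ (u : Zd 3 → EuclideanSpace ℝ (Fin 4)) (z : Zd 3) (R : ℤ),
        R₀ ≤ R →
        (∀ y, ‖u y‖ = 1) →
        (∀ (z' : Zd 3) (ρ : ℤ), 0 ≤ ρ → box z' (ρ + 1) ⊆ box z R →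
          ∀ v : Zd 3 → EuclideanSpace ℝ (Fin 4), (∀ y, y ∉ box z' ρ → v y = u y) → (∀ y ∈ box z' ρ, ‖v y‖ = 1) →
            ∑ y ∈ box z' (ρ + 1), ∑ μ : Fin 3, ‖u (y + unitVec μ) - u y‖ ^ 2 ≤
              (∑ y ∈ box z' (ρ + 1), ∑ μ : Fin 3, ‖v (y + unitVec μ) - v y‖ ^ 2) + δ * ((ρ : ℝ) + 1)) →
        (∑ y ∈ box z R, ∑ μ : Fin 3, ‖u (y + unitVec μ) - u y‖ ^ 2 ≤ Λ * R) →
        ∃ r : ℤ, 1 ≤ r ∧ (R : ℝ) ≤ C₀ * r ∧ 4 * r ≤ R ∧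
          ∑ y ∈ box z (2 * r), ∑ μ : Fin 3, ‖u (y + unitVec μ) - u y‖ ^ 2 ≤ Λ * r) →
    (∀ Λ : ℝ, 0 < Λ →
      ∃ (δ C₀ R₀ : ℝ), 0 < δ ∧ 1 ≤ C₀ ∧ 1 ≤ R₀ ∧
      ∀ (u : Zd 3 → EuclideanSpace ℝ (Fin 4)) (z : Zd 3) (R : ℤ),
        R₀ ≤ R →
        (∀ y, ‖u y‖ = 1) →
        (∀ (z' : Zd 3) (ρ : ℤ), 0 ≤ ρ → box z' (ρ + 1) ⊆ box z R →
          ∀ v : Zd 3 → EuclideanSpace ℝ (Fin 4), (∀ y, y ∉ box z' ρ → v y = u y) → (∀ y ∈ box z' ρ, ‖v y‖ = 1) →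
            ∑ y ∈ box z' (ρ + 1), ∑ μ : Fin 3, ‖u (y + unitVec μ) - u y‖ ^ 2 ≤
              (∑ y ∈ box z' (ρ + 1), ∑ μ : Fin 3, ‖v (y + unitVec μ) - v y‖ ^ 2) + δ * ((ρ : ℝ) + 1)) →
        (∑ y ∈ box z R, ∑ μ : Fin 3, ‖u (y + unitVec μ) - u y‖ ^ 2 ≤ Λ * R) →
        ∃ r : ℤ, 1 ≤ r ∧ (R : ℝ) ≤ C₀ * r ∧ 4 * r ≤ R ∧
          ∑ y ∈ box z (2 * r), ∑ μ : Fin 3, ‖u (y + unitVec μ) - u y‖ ^ 2 ≤ Λ * r)) := by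
  obtain ⟨Λs, hΛs, hsmall⟩ := halving_below_threshold
  refine ⟨Λs, hΛs, fun hlarge Λ hΛ => ?_⟩
  rcases le_or_gt Λ Λs with h | h
  · exact hsmall Λ hΛ h
  · exact hlarge Λ h.le

end Summit.QuantumFields.YangMills.Theorems.PoincareLipschitzFlatOrganBelowThreshold

end
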